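import Summits.KontsevichZagierPeriods.Zeta5Search.Certificates.PolyReflect3
import HarnessLib

/-!
# Shapes and 1-norms of dense polynomial data under the reflection algebra (cell `pub-zeta5`, certifier `cert-2`)

HONEST FRAMING: systematic search; no irrationality claim unless certified.

OUR infrastructure (Summit side). A-priori size control for the data types of P1's `PolyReflect` (`List ℤ`, `Poly2`) and
`Certificates/PolyReflect3` (`Poly3`, `LC`): row/block LENGTH bounds (kept as inline `∀` predicates) and the 1-NORM (`norm1/2/3`, sum of
absolute values of all stored coefficients) are propagated through `add*`, `smul*`, `mul*`, `neg3` (the norm is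
submultiplicative, lengths add); the propagation through linear combinations and elimination runs is
`Certificates/PolyReflectShadow.lean`. Purpose: the module-reduction checker of `PolyReflect3` is too slow when the kernel multiplies the
polynomials coefficient by coefficient; `Certificates/PolyReflectPack.lean` lets the kernel run the SAME elimination on
Kronecker-packed big integers (one GMP operation per polynomial operation) and needs exactly these bounds — for the
symbolic result it never computes — to conclude that a packed value `0` means the zero polynomial.
No mathematics specific to ζ(5) lives here.
-/

namespace Summit.KontsevichZagierPeriods.Zeta5Search.PolyReflect

/-! ### Level 1: coefficient lists -/

/-- 1-norm of a coefficient list. -/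
def norm1 : List ℤ → ℕ
  | [] => 0
  | a :: p => a.natAbs + norm1 p

/-- `norm1` of a cons. -/
@[simp] theorem norm1_cons (a : ℤ) (p : List ℤ) : norm1 (a :: p) = a.natAbs + norm1 p := rfl
/-- `norm1 [] = 0`. -/
@[simp] theorem norm1_nil : norm1 [] = 0 := rfl

/-- Every coefficient is bounded by the 1-norm. -/
theorem natAbs_le_norm1 : ∀ (p : List ℤ) (a : ℤ), a ∈ p → a.natAbs ≤ norm1 p
  | [], a, h => by simp at h
  | b :: p, a, h => by
    rcases List.mem_cons.1 h with rfl | h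
    · simp
    · have := natAbs_le_norm1 p a h; simp; omega

/-- Length of a sum. -/
theorem length_add1 : ∀ p q : List ℤ, (add1 p q).length = max p.length q.length
  | [], q => by simp [add1]
  | a :: p, [] => by simp [add1]
  | a :: p, b :: q => by simp [add1, length_add1 p q, Nat.succ_max_succ]

/-- Norm of a sum. -/
theorem norm1_add1 : ∀ p q : List ℤ, norm1 (add1 p q) ≤ norm1 p + norm1 q
  | [], q => by simp [add1]
  | a :: p, [] => by simp [add1]
  | a :: p, b :: q => by
    simp only [add1, norm1_cons]
    have := norm1_add1 p q; have := Int.natAbs_add_le a b; omega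

/-- Length of a scalar multiple. -/
theorem length_smul1 (c : ℤ) : ∀ p : List ℤ, (smul1 c p).length = p.length
  | [] => by simp [smul1]
  | a :: p => by simp [smul1, length_smul1 c p]

/-- Norm of a scalar multiple. -/
theorem norm1_smul1 (c : ℤ) : ∀ p : List ℤ, norm1 (smul1 c p) = c.natAbs * norm1 p
  | [] => by simp [smul1]
  | a :: p => by simp [smul1, norm1_smul1 c p, Int.natAbs_mul, Nat.mul_add]

/-- Length of a product. -/
theorem length_mul1 : ∀ p q : List ℤ, (mul1 p q).length ≤ max p.length (p.length + q.length - 1)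
  | [], q => by simp [mul1]
  | a :: p, q => by
    simp only [mul1, length_add1, length_smul1, List.length_cons]
    have := length_mul1 p q; omega

/-- Norm of a product (submultiplicativity). -/
theorem norm1_mul1 : ∀ p q : List ℤ, norm1 (mul1 p q) ≤ norm1 p * norm1 q
  | [], q => by simp [mul1]
  | a :: p, q => by
    simp only [mul1, norm1_cons]
    have h1 := norm1_add1 (smul1 a q) (0 :: mul1 p q)
    have h2 := norm1_mul1 p q
    rw [norm1_smul1] at h1
    simp only [norm1_cons, Int.natAbs_zero, zero_add] at h1
    nlinarith

/-! ### Level 2: `Poly2` (rows = coefficient lists in the first variable) -/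

/-- 1-norm of a `Poly2`. -/
def norm2 : Poly2 → ℕ
  | [] => 0
  | a :: p => norm1 a + norm2 p

/-- `norm2` of a cons. -/
@[simp] theorem norm2_cons (a : List ℤ) (p : Poly2) : norm2 (a :: p) = norm1 a + norm2 p := rfl
/-- `norm2 [] = 0`. -/
@[simp] theorem norm2_nil : norm2 [] = 0 := rfl

/-- "All rows have length `≤ W`" for a cons (the predicate `∀ r ∈ p, r.length ≤ W` is kept inline). -/
theorem rows_cons {W : ℕ} {a : List ℤ} {p : Poly2} :
    (∀ r ∈ a :: p, r.length ≤ W) ↔ a.length ≤ W ∧ ∀ r ∈ p, r.length ≤ W := by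
  simp

/-- Row bounds are monotone. -/
theorem rows_mono {W W' : ℕ} {p : Poly2} (h : ∀ r ∈ p, r.length ≤ W) (hW : W ≤ W') : ∀ r ∈ p, r.length ≤ W' :=
  fun r hr => (h r hr).trans hW

/-- Every row's norm is bounded by the total norm. -/
theorem norm1_le_norm2 : ∀ (p : Poly2) (r : List ℤ), r ∈ p → norm1 r ≤ norm2 p
  | [], r, h => by simp at h
  | b :: p, r, h => by
    rcases List.mem_cons.1 h with rfl | h
    · simp
    · have := norm1_le_norm2 p r h; simp; omega

/-- Length of a sum. -/
theorem length_add2 : ∀ p q : Poly2, (add2 p q).length = max p.length q.length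
  | [], q => by simp [add2]
  | a :: p, [] => by simp [add2]
  | a :: p, b :: q => by simp [add2, length_add2 p q, Nat.succ_max_succ]

/-- Row bound of a sum. -/
theorem rows_add2 : ∀ {W : ℕ} (p q : Poly2), (∀ r ∈ p, r.length ≤ W) → (∀ r ∈ q, r.length ≤ W) → (∀ r ∈ (add2 p q), r.length ≤ W)
  | W, [], q, _, hq => by simpa [add2] using hq
  | W, a :: p, [], hp, _ => by simpa [add2] using hp
  | W, a :: p, b :: q, hp, hq => by
    rw [rows_cons] at hp hq
    simp only [add2, rows_cons, length_add1]
    exact ⟨max_le hp.1 hq.1, rows_add2 p q hp.2 hq.2⟩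

/-- Norm of a sum. -/
theorem norm2_add2 : ∀ p q : Poly2, norm2 (add2 p q) ≤ norm2 p + norm2 q
  | [], q => by simp [add2]
  | a :: p, [] => by simp [add2]
  | a :: p, b :: q => by
    simp only [add2, norm2_cons]
    have := norm2_add2 p q; have := norm1_add1 a b; omega

/-- Length of a row-scalar multiple. -/
theorem length_smul2 (c : List ℤ) : ∀ p : Poly2, (smul2 c p).length = p.length
  | [] => by simp [smul2]
  | a :: p => by simp [smul2, length_smul2 c p]

/-- Row bound of a row-scalar multiple. -/
theorem rows_smul2 {Wc W : ℕ} (c : List ℤ) (hc : c.length ≤ Wc) (hW : 1 ≤ W) :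
    ∀ p : Poly2, (∀ r ∈ p, r.length ≤ W) → (∀ r ∈ (smul2 c p), r.length ≤ (Wc + W - 1))
  | [], _ => by simp [smul2]
  | a :: p, h => by
    rw [rows_cons] at h
    simp only [smul2, rows_cons]
    refine ⟨?_, rows_smul2 c hc hW p h.2⟩
    have := length_mul1 c a; omega

/-- Norm of a row-scalar multiple. -/
theorem norm2_smul2 (c : List ℤ) : ∀ p : Poly2, norm2 (smul2 c p) ≤ norm1 c * norm2 p
  | [] => by simp [smul2]
  | a :: p => by
    simp only [smul2, norm2_cons]
    have := norm2_smul2 c p; have := norm1_mul1 c a; nlinarith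

/-- Length of a product. -/
theorem length_mul2 : ∀ p q : Poly2, (mul2 p q).length ≤ max p.length (p.length + q.length - 1)
  | [], q => by simp [mul2]
  | a :: p, q => by
    simp only [mul2, length_add2, length_smul2, List.length_cons]
    have := length_mul2 p q; omega

/-- Row bound of a product. -/
theorem rows_mul2 {Wp Wq : ℕ} (hWp : 1 ≤ Wp) (hWq : 1 ≤ Wq) :
    ∀ p q : Poly2, (∀ r ∈ p, r.length ≤ Wp) → (∀ r ∈ q, r.length ≤ Wq) → (∀ r ∈ (mul2 p q), r.length ≤ (Wp + Wq - 1))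
  | [], q, _, _ => by simp [mul2]
  | a :: p, q, hp, hq => by
    rw [rows_cons] at hp
    simp only [mul2]
    refine rows_add2 _ _ ?_ ?_
    · have h := rows_smul2 a hp.1 hWq q hq
      exact h
    · rw [rows_cons]; exact ⟨by simp, rows_mul2 hWp hWq p q hp.2 hq⟩

/-- Norm of a product (submultiplicativity). -/
theorem norm2_mul2 : ∀ p q : Poly2, norm2 (mul2 p q) ≤ norm2 p * norm2 q
  | [], q => by simp [mul2]
  | a :: p, q => by
    simp only [mul2, norm2_cons]
    have h1 := norm2_add2 (smul2 a q) ([] :: mul2 p q)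
    have h2 := norm2_mul2 p q
    have h3 := norm2_smul2 a q
    simp only [norm2_cons, norm1_nil, zero_add] at h1
    nlinarith

/-! ### Level 3: `Poly3` (blocks = `Poly2`) -/

/-- 1-norm of a `Poly3`. -/
def norm3 : Poly3 → ℕ
  | [] => 0
  | a :: p => norm2 a + norm3 p

/-- `norm3` of a cons. -/
@[simp] theorem norm3_cons (a : Poly2) (p : Poly3) : norm3 (a :: p) = norm2 a + norm3 p := rfl
/-- `norm3 [] = 0`. -/
@[simp] theorem norm3_nil : norm3 [] = 0 := rfl

/-- SHAPE `(W, X)` of a `Poly3` — every block has `≤ X` rows and every row has length `≤ W` — for a cons (the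
predicate `∀ b ∈ p, b.length ≤ X ∧ ∀ r ∈ b, r.length ≤ W` is kept inline: no Prop-valued definitions in this file). -/
theorem sh3_cons {W X : ℕ} {a : Poly2} {p : Poly3} :
    (∀ b ∈ (a :: p), b.length ≤ X ∧ ∀ r ∈ b, r.length ≤ W) ↔
      (a.length ≤ X ∧ (∀ r ∈ a, r.length ≤ W)) ∧ (∀ b ∈ p, b.length ≤ X ∧ ∀ r ∈ b, r.length ≤ W) := by
  simp

/-- The empty `Poly3` has every shape. -/
theorem sh3_nil (W X : ℕ) : ∀ b ∈ ([] : Poly3), b.length ≤ X ∧ ∀ r ∈ b, r.length ≤ W := by simp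

/-- Shapes are monotone in the bounds. -/
theorem sh3_mono {W X W' X' : ℕ} {p : Poly3} (h : (∀ b ∈ p, b.length ≤ X ∧ ∀ r ∈ b, r.length ≤ W)) (hW : W ≤ W') (hX : X ≤ X') : (∀ b ∈ p, b.length ≤ X' ∧ ∀ r ∈ b, r.length ≤ W') :=
  fun b hb => ⟨(h b hb).1.trans hX, rows_mono (h b hb).2 hW⟩

/-- Every block's norm is bounded by the total norm. -/
theorem norm2_le_norm3 : ∀ (p : Poly3) (b : Poly2), b ∈ p → norm2 b ≤ norm3 p
  | [], b, h => by simp at h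
  | a :: p, b, h => by
    rcases List.mem_cons.1 h with rfl | h
    · simp
    · have := norm2_le_norm3 p b h; simp; omega

/-- Shape of a sum. -/
theorem sh3_add3 : ∀ {W X : ℕ} (p q : Poly3), (∀ b ∈ p, b.length ≤ X ∧ ∀ r ∈ b, r.length ≤ W) → (∀ b ∈ q, b.length ≤ X ∧ ∀ r ∈ b, r.length ≤ W) → (∀ b ∈ (add3 p q), b.length ≤ X ∧ ∀ r ∈ b, r.length ≤ W)
  | W, X, [], q, _, hq => by simpa [add3] using hq
  | W, X, a :: p, [], hp, _ => by simpa [add3] using hp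
  | W, X, a :: p, b :: q, hp, hq => by
    rw [sh3_cons] at hp hq
    simp only [add3, sh3_cons, length_add2]
    exact ⟨⟨max_le hp.1.1 hq.1.1, rows_add2 a b hp.1.2 hq.1.2⟩, sh3_add3 p q hp.2 hq.2⟩

/-- Norm of a sum. -/
theorem norm3_add3 : ∀ p q : Poly3, norm3 (add3 p q) ≤ norm3 p + norm3 q
  | [], q => by simp [add3]
  | a :: p, [] => by simp [add3]
  | a :: p, b :: q => by
    simp only [add3, norm3_cons]
    have := norm3_add3 p q; have := norm2_add2 a b; omega

/-- Shape of a block-scalar multiple. -/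
theorem sh3_smul3 {Wc Xc W X : ℕ} (c : Poly2) (hcX : c.length ≤ Xc) (hcW : (∀ r ∈ c, r.length ≤ Wc)) (hWc : 1 ≤ Wc) (hXc : 1 ≤ Xc)
    (hW : 1 ≤ W) (hX : 1 ≤ X) : ∀ p : Poly3, (∀ b ∈ p, b.length ≤ X ∧ ∀ r ∈ b, r.length ≤ W) → (∀ b ∈ (smul3 c p), b.length ≤ (Xc + X - 1) ∧ ∀ r ∈ b, r.length ≤ (Wc + W - 1))
  | [], _ => by simp [smul3]
  | a :: p, h => by
    rw [sh3_cons] at h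
    simp only [smul3, sh3_cons]
    refine ⟨⟨?_, rows_mul2 hWc hW c a hcW h.1.2⟩, sh3_smul3 c hcX hcW hWc hXc hW hX p h.2⟩
    have := length_mul2 c a; omega

/-- Norm of a block-scalar multiple. -/
theorem norm3_smul3 (c : Poly2) : ∀ p : Poly3, norm3 (smul3 c p) ≤ norm2 c * norm3 p
  | [] => by simp [smul3]
  | a :: p => by
    simp only [smul3, norm3_cons]
    have := norm3_smul3 c p; have := norm2_mul2 c a; nlinarith

/-- Shape of a product. -/
theorem sh3_mul3 {Wp Xp Wq Xq : ℕ} (hWp : 1 ≤ Wp) (hXp : 1 ≤ Xp) (hWq : 1 ≤ Wq) (hXq : 1 ≤ Xq) :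
    ∀ p q : Poly3, (∀ b ∈ p, b.length ≤ Xp ∧ ∀ r ∈ b, r.length ≤ Wp) → (∀ b ∈ q, b.length ≤ Xq ∧ ∀ r ∈ b, r.length ≤ Wq) → (∀ b ∈ (mul3 p q), b.length ≤ (Xp + Xq - 1) ∧ ∀ r ∈ b, r.length ≤ (Wp + Wq - 1))
  | [], q, _, _ => by simp [mul3]
  | a :: p, q, hp, hq => by
    rw [sh3_cons] at hp
    simp only [mul3]
    refine sh3_add3 _ _ (sh3_smul3 a hp.1.1 hp.1.2 hWp hXp hWq hXq q hq) ?_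
    rw [sh3_cons]
    exact ⟨⟨by simp, by simp⟩, sh3_mul3 hWp hXp hWq hXq p q hp.2 hq⟩

/-- Norm of a product (submultiplicativity). -/
theorem norm3_mul3 : ∀ p q : Poly3, norm3 (mul3 p q) ≤ norm3 p * norm3 q
  | [], q => by simp [mul3]
  | a :: p, q => by
    simp only [mul3, norm3_cons]
    have h1 := norm3_add3 (smul3 a q) ([] :: mul3 p q)
    have h2 := norm3_mul3 p q
    have h3 := norm3_smul3 a q
    simp only [norm3_cons, norm2_nil, zero_add] at h1
    nlinarith

/-- Shape of a negation. -/
theorem sh3_neg3 {W X : ℕ} (hW : 1 ≤ W) (hX : 1 ≤ X) (p : Poly3) (h : (∀ b ∈ p, b.length ≤ X ∧ ∀ r ∈ b, r.length ≤ W)) : (∀ b ∈ (neg3 p), b.length ≤ X ∧ ∀ r ∈ b, r.length ≤ W) := by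
  have := sh3_smul3 (Wc := 1) (Xc := 1) [[-1]] (by simp) (by simp) le_rfl le_rfl hW hX p h
  simpa [neg3] using this

/-- Norm of a negation. -/
theorem norm3_neg3 (p : Poly3) : norm3 (neg3 p) ≤ norm3 p := by
  have := norm3_smul3 [[-1]] p
  simpa [neg3, norm2, norm1] using this

end Summit.KontsevichZagierPeriods.Zeta5Search.PolyReflect
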